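import Mathlib
import Summits.MatrixMultiplication.MatrixMultiplication.Theses.SnSubsetDichotomy

/-!
# `SnSubsetDichotomy.PolynomialSlack`, line `transport-split-hull` — stub `stub_split`

The SPLIT CONFIGURATION of a triple `S, T, U ⊆ S_n` with the triple product property
(crux `stmt-MatrixMultiplication-8306`, registered stub `stub_split` of
`Cruxes/PolynomialSlack/Lines/transport-split-hull.lean`); this is the only place in the line where
the genuine three-fold condition is used.  Write `A = S⁻¹T₁ := image₂ (fun s t => s⁻¹ * t) S T₁`,
`B = T₂⁻¹U`, `C′ = S⁻¹U` for disjoint `T₁, T₂ ⊆ T`.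

* (a) `(A, B, C′)` is EXACTLY product-free: if `(s⁻¹t₁)(t₂⁻¹u) = s′⁻¹u′` then
  `s′s⁻¹ · t₁t₂⁻¹ · uu′⁻¹ = 1`, so the triple product property forces `t₁ = t₂ ∈ T₁ ∩ T₂ = ∅`.
* (b) The three quotient maps `(s,t) ↦ s⁻¹t` on `S × T₁`, `(t,u) ↦ t⁻¹u` on `T₂ × U` and
  `(s,u) ↦ s⁻¹u` on `S × U` are injective (the pairwise part of the property, with an element of the
  third set as a witness), hence the fibre counts against any test set `H` add up to `|A ∩ H|`,
  `|B ∩ H|`, `|C′ ∩ H|` exactly.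
* (c) Packing: `|S||T|, |T||U|, |S||U| ≤ n! = |S_n|` (the same injective maps land in `S_n`;
  Cohn–Umans 2003, proof of Lemma 3.1).

The injectivity lemmas `injOn_quot_first/second/outer` are adapted from
`Cruxes/PolynomialSlack/Lines/quotient-globalisation-by-pruning.lean` (`card_quot_first`,
`card_quot_outer`).
-/

-- `Summit.<Summit>.<Problem>` is the tree's mandated summit-side namespace; for this
-- single-conjunct summit the two coincide, so the file silences `dupNamespace`.
set_option linter.dupNamespace false

open scoped BigOperators
open Finset
open Literature.Combinatorics.Additive (TripleProductProperty)

namespace Summit.MatrixMultiplication.MatrixMultiplication.Theorems.PolynomialSlack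

section Group

variable {G : Type*} [Group G] {S T U : Finset G}

-- adapted from Cruxes/PolynomialSlack/Lines/quotient-globalisation-by-pruning.lean (card_quot_first)
/-- For a triple `S, T, U` with the triple product property and `U` non-empty, the quotient map
`(s,t) ↦ s⁻¹t` is injective on `S × T` (take `u ∈ U`; `s⁻¹t = s′⁻¹t′` gives the word
`s′s⁻¹ · tt′⁻¹ · uu⁻¹ = 1`). [folklore] -/
theorem injOn_quot_first (h : TripleProductProperty S T U) (hU : U.Nonempty) :
    Set.InjOn (fun x : G × G => x.1⁻¹ * x.2) (↑S ×ˢ ↑T : Set (G × G)) := by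
  obtain ⟨u, hu⟩ := hU
  rintro ⟨s, t⟩ hst ⟨s', t'⟩ hst' he
  simp only [Set.mem_prod, Finset.mem_coe] at hst hst'
  change s⁻¹ * t = s'⁻¹ * t' at he
  have key : s' * s⁻¹ * (t * t'⁻¹) * (u * u⁻¹) = 1 := by
    calc s' * s⁻¹ * (t * t'⁻¹) * (u * u⁻¹) = s' * (s⁻¹ * t) * t'⁻¹ := by group
      _ = s' * (s'⁻¹ * t') * t'⁻¹ := by rw [he]
      _ = 1 := by group
  obtain ⟨h1, h2, -⟩ := h s' hst'.1 s hst.1 t hst.2 t' hst'.2 u hu u hu key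
  exact Prod.ext h1.symm h2

-- adapted from Cruxes/PolynomialSlack/Lines/quotient-globalisation-by-pruning.lean (card_quot_first)
/-- For a triple `S, T, U` with the triple product property and `S` non-empty, the quotient map
`(t,u) ↦ t⁻¹u` is injective on `T × U` (take `s ∈ S`; `t⁻¹u = t′⁻¹u′` gives the word
`ss⁻¹ · t′t⁻¹ · uu′⁻¹ = 1`). [folklore] -/
theorem injOn_quot_second (h : TripleProductProperty S T U) (hS : S.Nonempty) :
    Set.InjOn (fun x : G × G => x.1⁻¹ * x.2) (↑T ×ˢ ↑U : Set (G × G)) := by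
  obtain ⟨s, hs⟩ := hS
  rintro ⟨t, u⟩ htu ⟨t', u'⟩ htu' he
  simp only [Set.mem_prod, Finset.mem_coe] at htu htu'
  change t⁻¹ * u = t'⁻¹ * u' at he
  have key : s * s⁻¹ * (t' * t⁻¹) * (u * u'⁻¹) = 1 := by
    calc s * s⁻¹ * (t' * t⁻¹) * (u * u'⁻¹) = t' * (t⁻¹ * u) * u'⁻¹ := by group
      _ = t' * (t'⁻¹ * u') * u'⁻¹ := by rw [he]
      _ = 1 := by group
  obtain ⟨-, h2, h3⟩ := h s hs s hs t' htu'.1 t htu.1 u htu.2 u' htu'.2 key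
  exact Prod.ext h2.symm h3

-- adapted from Cruxes/PolynomialSlack/Lines/quotient-globalisation-by-pruning.lean (card_quot_outer)
/-- For a triple `S, T, U` with the triple product property and `T` non-empty, the quotient map
`(s,u) ↦ s⁻¹u` is injective on `S × U` (take `t ∈ T`; `s⁻¹u = s′⁻¹u′` gives the word
`s′s⁻¹ · tt⁻¹ · uu′⁻¹ = 1`). [folklore] -/
theorem injOn_quot_outer (h : TripleProductProperty S T U) (hT : T.Nonempty) :
    Set.InjOn (fun x : G × G => x.1⁻¹ * x.2) (↑S ×ˢ ↑U : Set (G × G)) := by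
  obtain ⟨t, ht⟩ := hT
  rintro ⟨s, u⟩ hsu ⟨s', u'⟩ hsu' he
  simp only [Set.mem_prod, Finset.mem_coe] at hsu hsu'
  change s⁻¹ * u = s'⁻¹ * u' at he
  have key : s' * s⁻¹ * (t * t⁻¹) * (u * u'⁻¹) = 1 := by
    calc s' * s⁻¹ * (t * t⁻¹) * (u * u'⁻¹) = s' * (s⁻¹ * u) * u'⁻¹ := by group
      _ = s' * (s'⁻¹ * u') * u'⁻¹ := by rw [he]
      _ = 1 := by group
  obtain ⟨h1, -, h3⟩ := h s' hsu'.1 s hsu.1 t ht t ht u hsu.2 u' hsu'.2 key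
  exact Prod.ext h1.symm h3

variable [DecidableEq G]

/-- If the quotient map `(x,y) ↦ x⁻¹y` is injective on `X × Y`, then for every test set `H` the
number of pairs `(x,y) ∈ X × Y` with `x⁻¹y ∈ H` is `|X⁻¹Y ∩ H|` (the filtered product maps
bijectively onto `image₂ (fun x y => x⁻¹ * y) X Y ∩ H`). [folklore] -/
theorem card_filter_product_eq_card_image₂_inter {X Y : Finset G}
    (hinj : Set.InjOn (fun x : G × G => x.1⁻¹ * x.2) (↑X ×ˢ ↑Y : Set (G × G)))
    (H : Finset G) :
    ((X ×ˢ Y).filter (fun xy => xy.1⁻¹ * xy.2 ∈ H)).card =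
      (Finset.image₂ (fun x y => x⁻¹ * y) X Y ∩ H).card := by
  have himg : Finset.image₂ (fun x y => x⁻¹ * y) X Y =
      (X ×ˢ Y).image (fun xy : G × G => xy.1⁻¹ * xy.2) := rfl
  rw [himg, ← Finset.filter_mem_eq_inter, Finset.filter_image]
  refine (Finset.card_image_of_injOn (hinj.mono ?_)).symm
  intro xy hxy
  simp only [Finset.coe_filter, Set.mem_setOf_eq] at hxy
  simpa only [Finset.coe_product] using (Finset.mem_coe.2 hxy.1)

/-- Fibre counts over the second coordinate add up to the filtered product:
`∑_{y ∈ Y} #{x ∈ X | x⁻¹y ∈ H} = #{(x,y) ∈ X × Y | x⁻¹y ∈ H}`. [folklore] -/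
theorem sum_card_filter_left_eq_card_filter_product (X Y H : Finset G) :
    ∑ y ∈ Y, (X.filter (fun x => x⁻¹ * y ∈ H)).card =
      ((X ×ˢ Y).filter (fun xy => xy.1⁻¹ * xy.2 ∈ H)).card := by
  rw [Finset.card_filter, Finset.sum_product_right]
  refine Finset.sum_congr rfl fun y _ => ?_
  rw [Finset.card_filter]

/-- Fibre counts over the first coordinate add up to the filtered product:
`∑_{x ∈ X} #{y ∈ Y | x⁻¹y ∈ H} = #{(x,y) ∈ X × Y | x⁻¹y ∈ H}`. [folklore] -/
theorem sum_card_filter_right_eq_card_filter_product (X Y H : Finset G) :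
    ∑ x ∈ X, (Y.filter (fun y => x⁻¹ * y ∈ H)).card =
      ((X ×ˢ Y).filter (fun xy => xy.1⁻¹ * xy.2 ∈ H)).card := by
  rw [Finset.card_filter, Finset.sum_product]
  refine Finset.sum_congr rfl fun x _ => ?_
  rw [Finset.card_filter]

/-- Exact product-freeness of the split configuration: for a triple `S, T, U` with the triple
product property and disjoint `T₁, T₂ ⊆ T`, no product of an element of `S⁻¹T₁` with an element of
`T₂⁻¹U` lies in `S⁻¹U` (`(s⁻¹t₁)(t₂⁻¹u) = s′⁻¹u′` gives `s′s⁻¹ · t₁t₂⁻¹ · uu′⁻¹ = 1`, whence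
`t₁ = t₂ ∈ T₁ ∩ T₂ = ∅`). [folklore] -/
theorem split_productFree {T₁ T₂ : Finset G} (hTPP : TripleProductProperty S T U)
    (h₁ : T₁ ⊆ T) (h₂ : T₂ ⊆ T) (hdisj : Disjoint T₁ T₂) :
    ∀ x ∈ Finset.image₂ (fun s t => s⁻¹ * t) S T₁, ∀ y ∈ Finset.image₂ (fun t u => t⁻¹ * u) T₂ U,
      x * y ∉ Finset.image₂ (fun s u => s⁻¹ * u) S U := by
  intro x hx y hy hxy
  obtain ⟨s, hs, t₁, ht₁, rfl⟩ := Finset.mem_image₂.1 hx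
  obtain ⟨t₂, ht₂, u, hu, rfl⟩ := Finset.mem_image₂.1 hy
  obtain ⟨s', hs', u', hu', he⟩ := Finset.mem_image₂.1 hxy
  have key : s' * s⁻¹ * (t₁ * t₂⁻¹) * (u * u'⁻¹) = 1 := by
    calc s' * s⁻¹ * (t₁ * t₂⁻¹) * (u * u'⁻¹) = s' * (s⁻¹ * t₁ * (t₂⁻¹ * u)) * u'⁻¹ := by group
      _ = s' * (s'⁻¹ * u') * u'⁻¹ := by rw [he]
      _ = 1 := by group
  obtain ⟨-, h12, -⟩ := hTPP s' hs' s hs t₁ (h₁ ht₁) t₂ (h₂ ht₂) u hu u' hu' key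
  exact Finset.disjoint_left.1 hdisj ht₁ (h12 ▸ ht₂)

end Group

/-- Packing in `S_n`: if `(x,y) ↦ x⁻¹y` is injective on `X × Y ⊆ S_n × S_n`, then
`|X||Y| ≤ n!`. [folklore] -/
theorem card_mul_card_le_factorial_of_injOn {n : ℕ} {X Y : Finset (Equiv.Perm (Fin n))}
    (hinj : Set.InjOn (fun x : Equiv.Perm (Fin n) × Equiv.Perm (Fin n) => x.1⁻¹ * x.2)
      (↑X ×ˢ ↑Y : Set (Equiv.Perm (Fin n) × Equiv.Perm (Fin n)))) :
    X.card * Y.card ≤ n.factorial := by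
  have hcard : Fintype.card (Equiv.Perm (Fin n)) = n.factorial := by
    rw [Fintype.card_perm, Fintype.card_fin]
  rw [← (Finset.card_image₂_iff (f := fun x y : Equiv.Perm (Fin n) => x⁻¹ * y)).2 hinj, ← hcard]
  exact Finset.card_le_univ _

/-- **Stub `stub_split` — the split configuration** (line `transport-split-hull` of crux
`PolynomialSlack`; the only use of the three-fold triple product property).  For a triple
`S, T, U ⊆ S_n` with the triple product property, all three sets non-empty, and disjoint
`T₁, T₂ ⊆ T`: (a) `(S⁻¹T₁, T₂⁻¹U, S⁻¹U)` is exactly product-free; (b) the fibre counts of the three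
quotient maps `(s,t) ↦ s⁻¹t` on `S × T₁`, `(t,u) ↦ t⁻¹u` on `T₂ × U`, `(s,u) ↦ s⁻¹u` on `S × U`
against every test set `H` are exactly `|S⁻¹T₁ ∩ H|`, `|T₂⁻¹U ∩ H|`, `|S⁻¹U ∩ H|` (injectivity,
from the pairwise part of the property); (c) packing `|S||T|, |T||U|, |S||U| ≤ n!`. [folklore] -/
theorem stub_split (n : ℕ) (S T U T₁ T₂ : Finset (Equiv.Perm (Fin n)))
    (hTPP : TripleProductProperty S T U) (hS : S.Nonempty) (hT : T.Nonempty) (hU : U.Nonempty)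
    (h₁ : T₁ ⊆ T) (h₂ : T₂ ⊆ T) (hdisj : Disjoint T₁ T₂) :
    (∀ x ∈ Finset.image₂ (fun s t => s⁻¹ * t) S T₁, ∀ y ∈ Finset.image₂ (fun t u => t⁻¹ * u) T₂ U,
        x * y ∉ Finset.image₂ (fun s u => s⁻¹ * u) S U) ∧
    (∀ H : Finset (Equiv.Perm (Fin n)),
        ∑ t ∈ T₁, (S.filter (fun s => s⁻¹ * t ∈ H)).card =
          (Finset.image₂ (fun s t => s⁻¹ * t) S T₁ ∩ H).card) ∧
    (∀ H : Finset (Equiv.Perm (Fin n)),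
        ∑ t ∈ T₂, (U.filter (fun u => t⁻¹ * u ∈ H)).card =
          (Finset.image₂ (fun t u => t⁻¹ * u) T₂ U ∩ H).card) ∧
    (∀ H : Finset (Equiv.Perm (Fin n)),
        ((S ×ˢ U).filter (fun su => su.1⁻¹ * su.2 ∈ H)).card =
          (Finset.image₂ (fun s u => s⁻¹ * u) S U ∩ H).card) ∧
    S.card * T.card ≤ n.factorial ∧ T.card * U.card ≤ n.factorial ∧
      S.card * U.card ≤ n.factorial := by
  -- the triple product property passes to the sub-triples `(S, T₁, U)` and `(S, T₂, U)`
  have hTPP₁ : TripleProductProperty S T₁ U := hTPP.mono subset_rfl h₁ subset_rfl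
  have hTPP₂ : TripleProductProperty S T₂ U := hTPP.mono subset_rfl h₂ subset_rfl
  refine ⟨split_productFree hTPP h₁ h₂ hdisj, fun H => ?_, fun H => ?_, fun H => ?_, ?_, ?_, ?_⟩
  · rw [sum_card_filter_left_eq_card_filter_product]
    exact card_filter_product_eq_card_image₂_inter (injOn_quot_first hTPP₁ hU) H
  · rw [sum_card_filter_right_eq_card_filter_product]
    exact card_filter_product_eq_card_image₂_inter (injOn_quot_second hTPP₂ hS) H
  · exact card_filter_product_eq_card_image₂_inter (injOn_quot_outer hTPP hT) H
  · exact card_mul_card_le_factorial_of_injOn (injOn_quot_first hTPP hU)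
  · exact card_mul_card_le_factorial_of_injOn (injOn_quot_second hTPP hS)
  · exact card_mul_card_le_factorial_of_injOn (injOn_quot_outer hTPP hT)

end Summit.MatrixMultiplication.MatrixMultiplication.Theorems.PolynomialSlack
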